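import Literature.MathematicalPhysics.QuantumFieldTheory.Balaban1983to89.BlockAveragingPlaquetteBoundLocal
import Literature.MathematicalPhysics.QuantumFieldTheory.Balaban1983to89.BlockAveragingSU2
import HarnessLib

/-!
# Smallness propagation for the block averaging `blockAvg su2Mean` of the registered stub `stub_averagedPlaquetteRarity` (crux `UVSeamRec`, stmt-QuantumFields-20043)

The registered skeleton `Lines/rarity_union_bound.lean` (and every export line of route `BalabanFluctuationExport`) conditions on /
measures the `k`-fold Bałaban block average `Q_k = Averaging.iter (blockAvg su2Mean) k ∘ ofConfig` built with the QUATERNIONIC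
PROJECTED MEAN `su2Mean` (`BlockAveragingSU2`), not with the printed `exp[mean log]` (`expMeanLogSU`) for which the Literature proves
[Balaban1985Averaging] Prop. 1 («averages of small fields are small»: `BlockAveragingPlaquetteBound(Local)`).  This file supplies the
same one-step smallness propagation FOR `su2Mean`, the deterministic input any attack on `AveragedPlaquetteRarity` at depth `k ≥ 1`
(or on `SmallFieldOscillation`) starts from:

* `SU2Mean.dist1_mean_le` — the projected mean of a nonempty finite family within `t < 1` of `1` is within `2t` of `1`
  (`‖q/n − 1‖ ≤ t` for the barycentre `q = Σ W_i`, `‖q‖ = √det q`, `|‖q‖ − n| ≤ ‖q − n·1‖`);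
* `dist1_su2Mean_avg_le`, `dist1_corr_su2Mean_le(_local)` — hence each correction factor of (0.4) is within `2t`,
  `t = (((d+2)L)²/4)·a`, of `1` when the fine plaquettes (globally, resp. in the three blocks of the bond) are within `a` of `1` and `t < 1`;
* `dist1_plaqHol_blockAvg_su2Mean_lt(_local)`, `plaqSmall_blockAvg_su2Mean`, `plaqSmallOn_blockAvg_su2Mean_of_near` — the coarse
  plaquettes of `blockAvg su2Mean U` are within `(L² + 2((d+2)L)²)·a` of `1` (axial `L × L` square `< L²a`,
  `B10Eq47AxialChi.dist1_plaqHol_axialAvg_le`, plus four correction factors, `dist1_plaquette_with_corr_le`), globally and in the LOCAL /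
  `PlaqSmallOn` forms of `BlockAveragingPlaquetteBoundLocal` (only the fine plaquettes based in the blocks at `ℓ^∞`-distance `≤ 1` matter).

Elementary; nothing probabilistic; the depths `k ≥ 1` of the stub (uniformity in `k` = asymptotic freedom) are NOT touched; YM mass gap NOT proved.
-/

set_option autoImplicit false

noncomputable section

open scoped Matrix.Norms.L2Operator ComplexOrder BigOperators

namespace Summit.QuantumFields.YangMills.Cruxes.UVSeamRec.RarityUnionBound

open Literature.MathematicalPhysics.QuantumFieldTheory.Balaban1983to89
open Literature.MathematicalPhysics.QuantumFieldTheory.Balaban1983to89.BlockAveraging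
open Literature.MathematicalPhysics.QuantumFieldTheory.Balaban1983to89.BlockAveragingPlaquetteBound
open Literature.MathematicalPhysics.QuantumFieldTheory.Balaban1983to89.BlockAveragingPlaquetteBoundLocal
open Literature.MathematicalPhysics.QuantumFieldTheory.Balaban1983to89.LatticeWordStokes

/-! ## §1 The projected mean of a small family is small -/

namespace SU2Mean

open Literature.MathematicalPhysics.QuantumFieldTheory.Balaban1983to89.SU2Mean

variable {ι : Type*} [Fintype ι]

/-- **The quaternionic projected mean of a small family is small**: if every `W_i ∈ SU(2)` of a nonempty finite family is within
`t < 1` of `1` (operator norm) then `dist1 (mean W) ≤ 2t`.  With `q = Σ_i W_i`, `n = |ι|`: `‖q − n·1‖ ≤ nt`, `‖q‖² = det q`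
(`q q† = det q · 1`), `mean W = q/‖q‖`, and `‖q/‖q‖ − 1‖ ≤ ‖q/‖q‖ − q/n‖ + ‖q/n − 1‖ = |1 − ‖q‖/n| + ‖q − n·1‖/n ≤ 2t`. -/
theorem dist1_mean_le [Nonempty ι] (W : ι → Matrix.specialUnitaryGroup (Fin 2) ℂ) {t : ℝ}
    (hW : ∀ i, dist1 (W i) ≤ t) (ht : t < 1) : dist1 (mean W) ≤ 2 * t := by
  have hW1 : ∀ i, dist1 (W i) < 1 := fun i => (hW i).trans_lt ht
  have hdet : (qsum W).det ≠ 0 := det_qsum_ne_zero_of_dist1_lt_one W hW1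
  set q : Matrix (Fin 2) (Fin 2) ℂ := qsum W with hq
  set D : ℝ := (q.det).re with hD
  have hDpos : 0 < D := det_qsum_re_pos W hdet
  set n : ℕ := Fintype.card ι with hn
  have hn0 : 0 < (n : ℝ) := Nat.cast_pos.mpr Fintype.card_pos
  have ht0 : 0 ≤ t := (GaugeGroup.dist1_nonneg _).trans (hW (Classical.arbitrary ι))
  -- `‖q‖² = D`
  have hsq : ‖q‖ * ‖q‖ = D := by
    have h1 : ‖q * star q‖ = ‖q‖ * ‖q‖ := CStarRing.norm_self_mul_star
    rw [← h1, hq, qsum_mul_star, det_qsum_eq_ofReal, norm_smul, Complex.norm_real, CStarRing.norm_one, mul_one,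
      Real.norm_of_nonneg (det_qsum_re_nonneg W)]
  set r : ℝ := ‖q‖ with hr
  have hr0 : 0 < r := by
    have hr_nn : 0 ≤ r := norm_nonneg q
    rcases hr_nn.lt_or_eq with h | h
    · exact h
    · exfalso; rw [← h, mul_zero] at hsq; linarith
  have hrD : Real.sqrt D = r := by
    rw [← hsq, Real.sqrt_mul_self hr0.le]
  -- `‖q − n·1‖ ≤ n t`
  have hone : ‖((n : ℝ) : ℂ) • (1 : Matrix (Fin 2) (Fin 2) ℂ)‖ = n := by
    rw [norm_smul, Complex.norm_real, CStarRing.norm_one, mul_one, Real.norm_of_nonneg hn0.le]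
  have hdiff : ‖q - ((n : ℝ) : ℂ) • (1 : Matrix (Fin 2) (Fin 2) ℂ)‖ ≤ n * t := by
    have hsum : q - ((n : ℝ) : ℂ) • (1 : Matrix (Fin 2) (Fin 2) ℂ) =
        ∑ i, ((W i : Matrix (Fin 2) (Fin 2) ℂ) - 1) := by
      rw [Finset.sum_sub_distrib, Finset.sum_const, Finset.card_univ, ← hn, hq, qsum,
        Complex.ofReal_natCast, Nat.cast_smul_eq_nsmul]
    rw [hsum]
    calc ‖∑ i, ((W i : Matrix (Fin 2) (Fin 2) ℂ) - 1)‖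
        ≤ ∑ i, ‖(W i : Matrix (Fin 2) (Fin 2) ℂ) - 1‖ := norm_sum_le _ _
      _ ≤ ∑ _i : ι, t := Finset.sum_le_sum fun i _ => by rw [← dist1_eq_norm]; exact hW i
      _ = n * t := by rw [Finset.sum_const, Finset.card_univ, ← hn, nsmul_eq_mul]
  -- `|r − n| ≤ n t`
  have hrn : |r - n| ≤ n * t := by
    have h := abs_norm_sub_norm_le q (((n : ℝ) : ℂ) • (1 : Matrix (Fin 2) (Fin 2) ℂ))
    rw [hone] at h
    exact h.trans hdiff
  -- the mean as a matrix
  have hmean : ((mean W : Matrix.specialUnitaryGroup (Fin 2) ℂ) : Matrix (Fin 2) (Fin 2) ℂ) = ((r⁻¹ : ℝ) : ℂ) • q := by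
    rw [coe_mean, projMat_of_ne hdet, ← hD, hrD]
  rw [dist1_eq_norm, hmean]
  -- split `r⁻¹ q − 1 = (r⁻¹ q − n⁻¹ q) + (n⁻¹ q − 1)`
  have hA : ‖((r⁻¹ : ℝ) : ℂ) • q - (((n : ℝ)⁻¹ : ℝ) : ℂ) • q‖ ≤ t := by
    rw [← sub_smul, ← Complex.ofReal_sub, norm_smul, Complex.norm_real, ← hr, Real.norm_eq_abs]
    have e : |r⁻¹ - (n : ℝ)⁻¹| * r = |r - n| / n := by
      rw [show r⁻¹ - (n : ℝ)⁻¹ = (n - r) / (r * n) by field_simp, abs_div, abs_of_pos (mul_pos hr0 hn0),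
        abs_sub_comm]
      field_simp
    rw [e, div_le_iff₀ hn0]
    linarith
  have hB : ‖(((n : ℝ)⁻¹ : ℝ) : ℂ) • q - 1‖ ≤ t := by
    have e : (((n : ℝ)⁻¹ : ℝ) : ℂ) • q - 1 =
        (((n : ℝ)⁻¹ : ℝ) : ℂ) • (q - ((n : ℝ) : ℂ) • (1 : Matrix (Fin 2) (Fin 2) ℂ)) := by
      rw [smul_sub, smul_smul, ← Complex.ofReal_mul, inv_mul_cancel₀ hn0.ne', Complex.ofReal_one, one_smul]
    rw [e, norm_smul, Complex.norm_real, Real.norm_of_nonneg (inv_nonneg.mpr hn0.le)]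
    calc (n : ℝ)⁻¹ * ‖q - ((n : ℝ) : ℂ) • (1 : Matrix (Fin 2) (Fin 2) ℂ)‖ ≤ (n : ℝ)⁻¹ * (n * t) :=
          mul_le_mul_of_nonneg_left hdiff (inv_nonneg.mpr hn0.le)
      _ = t := by field_simp
  calc ‖((r⁻¹ : ℝ) : ℂ) • q - 1‖
      ≤ ‖((r⁻¹ : ℝ) : ℂ) • q - (((n : ℝ)⁻¹ : ℝ) : ℂ) • q‖ + ‖(((n : ℝ)⁻¹ : ℝ) : ℂ) • q - 1‖ :=
        norm_sub_le_norm_sub_add_norm_sub _ _ _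
    _ ≤ t + t := add_le_add hA hB
    _ = 2 * t := by ring

end SU2Mean

/-! ## §2 The correction factors of (0.4) for `su2Mean` -/

/-- The `su2Mean` average (through the fixed enumeration) of a nonempty finite family within `t < 1` of `1` is within `2t` of `1`. -/
theorem dist1_su2Mean_avg_le {ι : Type*} [Fintype ι] [Nonempty ι] {W : ι → Matrix.specialUnitaryGroup (Fin 2) ℂ} {t : ℝ}
    (hW : ∀ i, dist1 (W i) ≤ t) (ht : t < 1) : dist1 (su2Mean.avg W) ≤ 2 * t := by
  unfold LoopAverage.avg
  rw [su2Mean_E]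
  exact SU2Mean.dist1_mean_le _ (fun i => hW _) ht

variable {P : Params} {j : ℕ}

/-- **The correction factor is close to `1` (global hypothesis)**: under `PlaqSmall a U` (`a ≥ 0`) with `t := (((d+2)L)²/4)·a < 1`
(the radius of `su2Mean`), `dist1 (corr su2Mean U c) ≤ 2t` for every coarse bond `c`. -/
theorem dist1_corr_su2Mean_le {a : ℝ} (ha : 0 ≤ a) {U : GaugeField P j (Matrix.specialUnitaryGroup (Fin 2) ℂ)}
    (hU : PlaqSmall a U) (ht : ((((P.d + 2) * P.L : ℕ) : ℝ) ^ 2 / 4) * a < 1) (c : PBond P (j + 1)) :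
    dist1 (corr su2Mean U c) ≤ 2 * (((((P.d + 2) * P.L : ℕ) : ℝ) ^ 2 / 4) * a) := by
  have hsmall : Small su2Mean U c := small_of_plaqSmall _ ha hU (by rw [su2Mean_δ]; exact ht) c
  unfold corr
  rw [if_pos hsmall]
  exact dist1_su2Mean_avg_le (fun i => dist1_loopHol_le ha hU c i) ht

/-- **The correction factor is close to `1` (local hypothesis)**: if the fine plaquettes based in the three blocks
`B(c₋ − e_μ) ∪ B(c₋) ∪ B(c₊)` of the coarse bond `c` are within `a ≥ 0` of `1` and `t := (((d+2)L)²/4)·a < 1`, then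
`dist1 (corr su2Mean U c) ≤ 2t` (standing range `j + 1 ≤ m + K`). -/
theorem dist1_corr_su2Mean_le_local {a : ℝ} (ha : 0 ≤ a) (hj : j + 1 ≤ P.m + P.K)
    {U : GaugeField P j (Matrix.specialUnitaryGroup (Fin 2) ℂ)} (c : PBond P (j + 1))
    (hU : ∀ q : Plaq P j, (blockOf q.src = c.src.unshift c.dir ∨ blockOf q.src = c.src ∨ blockOf q.src = c.tgt) →
      dist1 (GaugeField.plaqHol U q) < a)
    (ht : ((((P.d + 2) * P.L : ℕ) : ℝ) ^ 2 / 4) * a < 1) :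
    dist1 (corr su2Mean U c) ≤ 2 * (((((P.d + 2) * P.L : ℕ) : ℝ) ^ 2 / 4) * a) := by
  have hsmall : Small su2Mean U c := small_of_plaqSmallOn_blocks _ ha hj c hU (by rw [su2Mean_δ]; exact ht)
  unfold corr
  rw [if_pos hsmall]
  exact dist1_su2Mean_avg_le (fun i => dist1_loopHol_le_local ha hj c hU i) ht

/-! ## §3 The coarse plaquettes of `blockAvg su2Mean U` -/

/-- **The coarse plaquettes of the `su2Mean`-averaged field (global hypothesis)**: under `PlaqSmall a U` (`a ≥ 0`),
`(((d+2)L)²/4)·a < 1`, standing range: every plaquette of `Ū = avgFun su2Mean U` satisfies `dist1 < (L² + 2((d+2)L)²)·a`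
(axial square `< L²a` plus four correction factors `≤ 2t` each). -/
theorem dist1_plaqHol_blockAvg_su2Mean_lt (hj : j + 1 ≤ P.m + P.K) {a : ℝ} (ha : 0 ≤ a)
    {U : GaugeField P j (Matrix.specialUnitaryGroup (Fin 2) ℂ)}
    (hU : PlaqSmall a U) (ht : ((((P.d + 2) * P.L : ℕ) : ℝ) ^ 2 / 4) * a < 1) (p : Plaq P (j + 1)) :
    dist1 (GaugeField.plaqHol (avgFun su2Mean U) p) <
      ((P.L : ℝ) ^ 2 + 2 * (((P.d + 2) * P.L : ℕ) : ℝ) ^ 2) * a := by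
  have hax := B10Eq47AxialChi.plaqSmall_axialAvg hj hU p
  have hc := fun c => dist1_corr_su2Mean_le ha hU ht c
  have hins := dist1_plaquette_with_corr_le
    (corr su2Mean U ⟨p.src, p.μ⟩) (AveragingRT.axialAvg U ⟨p.src, p.μ⟩)
    (corr su2Mean U ⟨p.src.shift p.μ, p.ν⟩) (AveragingRT.axialAvg U ⟨p.src.shift p.μ, p.ν⟩)
    (corr su2Mean U ⟨p.src.shift p.ν, p.μ⟩) (AveragingRT.axialAvg U ⟨p.src.shift p.ν, p.μ⟩)
    (corr su2Mean U ⟨p.src, p.ν⟩) (AveragingRT.axialAvg U ⟨p.src, p.ν⟩)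
  have h1 := hc ⟨p.src, p.μ⟩
  have h2 := hc ⟨p.src.shift p.μ, p.ν⟩
  have h3 := hc ⟨p.src.shift p.ν, p.μ⟩
  have h4 := hc ⟨p.src, p.ν⟩
  have hax' : dist1 (AveragingRT.axialAvg U ⟨p.src, p.μ⟩ * AveragingRT.axialAvg U ⟨p.src.shift p.μ, p.ν⟩ *
      (AveragingRT.axialAvg U ⟨p.src.shift p.ν, p.μ⟩)⁻¹ * (AveragingRT.axialAvg U ⟨p.src, p.ν⟩)⁻¹) < (P.L : ℝ) ^ 2 * a := hax
  show dist1 (corr _ U ⟨p.src, p.μ⟩ * AveragingRT.axialAvg U ⟨p.src, p.μ⟩ *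
      (corr _ U ⟨p.src.shift p.μ, p.ν⟩ * AveragingRT.axialAvg U ⟨p.src.shift p.μ, p.ν⟩) *
      (corr _ U ⟨p.src.shift p.ν, p.μ⟩ * AveragingRT.axialAvg U ⟨p.src.shift p.ν, p.μ⟩)⁻¹ *
      (corr _ U ⟨p.src, p.ν⟩ * AveragingRT.axialAvg U ⟨p.src, p.ν⟩)⁻¹) < _
  nlinarith

/-- **`PlaqSmall` form**: `PlaqSmall a U`, `0 ≤ a`, `(((d+2)L)²/4)·a < 1`, standing range ⇒
`PlaqSmall ((L² + 2((d+2)L)²)·a) ((blockAvg su2Mean).avg U)`. -/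
theorem plaqSmall_blockAvg_su2Mean (hj : j + 1 ≤ P.m + P.K) {a : ℝ} (ha : 0 ≤ a)
    {U : GaugeField P j (Matrix.specialUnitaryGroup (Fin 2) ℂ)}
    (hU : PlaqSmall a U) (ht : ((((P.d + 2) * P.L : ℕ) : ℝ) ^ 2 / 4) * a < 1) :
    PlaqSmall (((P.L : ℝ) ^ 2 + 2 * (((P.d + 2) * P.L : ℕ) : ℝ) ^ 2) * a) ((blockAvg su2Mean).avg U) :=
  fun p => dist1_plaqHol_blockAvg_su2Mean_lt hj ha hU ht p

/-- **The coarse plaquettes of the `su2Mean`-averaged field (local hypothesis)**: if every fine plaquette based in one of the nine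
blocks `y, y ± e_μ, y ± e_ν, y + e_μ + e_ν, y + e_ν + e_μ, y + e_μ − e_ν, y + e_ν − e_μ` around the coarse plaquette `p′ = ⟨y, μ, ν⟩` is
within `a ≥ 0` of `1` and `(((d+2)L)²/4)·a < 1`, then `dist1 (Ū(∂p′)) < (L² + 2((d+2)L)²)·a` (`Ū = avgFun su2Mean U`, standing range). -/
theorem dist1_plaqHol_blockAvg_su2Mean_lt_local (hj : j + 1 ≤ P.m + P.K) {a : ℝ} (ha : 0 ≤ a)
    {U : GaugeField P j (Matrix.specialUnitaryGroup (Fin 2) ℂ)} (p : Plaq P (j + 1))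
    (hU : ∀ q : Plaq P j, blockOf q.src ∈ [p.src, p.src.shift p.μ, p.src.unshift p.μ, p.src.shift p.ν, p.src.unshift p.ν,
        (p.src.shift p.μ).shift p.ν, (p.src.shift p.ν).shift p.μ, (p.src.shift p.μ).unshift p.ν, (p.src.shift p.ν).unshift p.μ] →
      dist1 (GaugeField.plaqHol U q) < a)
    (ht : ((((P.d + 2) * P.L : ℕ) : ℝ) ^ 2 / 4) * a < 1) :
    dist1 (GaugeField.plaqHol (avgFun su2Mean U) p) <
      ((P.L : ℝ) ^ 2 + 2 * (((P.d + 2) * P.L : ℕ) : ℝ) ^ 2) * a := by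
  have hμν : p.μ ≠ p.ν := ne_of_lt p.hμν
  -- the axial square
  have hL : (Finset.range P.L).Nonempty := Finset.nonempty_range_iff.mpr (ne_of_gt P.L_pos)
  have hax : dist1 (GaugeField.plaqHol (AveragingRT.axialAvg U) p) < (P.L : ℝ) ^ 2 * a := by
    refine (B10Eq47AxialChi.dist1_plaqHol_axialAvg_le hj U p).trans_lt ?_
    calc ∑ t ∈ Finset.range P.L, ∑ s ∈ Finset.range P.L,
            dist1 (GaugeField.plaqHol U ⟨B10Eq47AxialChi.shiftN (B10Eq47AxialChi.shiftN (emb p.src) p.ν t) p.μ s, p.μ, p.ν, p.hμν⟩)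
        < ∑ _t ∈ Finset.range P.L, ∑ _s ∈ Finset.range P.L, a :=
          Finset.sum_lt_sum_of_nonempty hL fun t htL => Finset.sum_lt_sum_of_nonempty hL fun s hsL => hU _ (by
            have hb := blockOf_square hj p.src hμν (Finset.mem_range.mp hsL) (Finset.mem_range.mp htL)
            rcases hb with h | h | h | h <;> simp [h])
      _ = (P.L : ℝ) ^ 2 * a := by simp [Finset.sum_const, Finset.card_range]; ring
  -- the four correction factors
  have h1 := dist1_corr_su2Mean_le_local ha hj ⟨p.src, p.μ⟩ (fun q hq => hU q (by
    simp only [PBond.tgt] at hq; rcases hq with h | h | h <;> simp [h])) ht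
  have h2 := dist1_corr_su2Mean_le_local ha hj ⟨p.src.shift p.μ, p.ν⟩ (fun q hq => hU q (by
    simp only [PBond.tgt] at hq; rcases hq with h | h | h <;> simp [h])) ht
  have h3 := dist1_corr_su2Mean_le_local ha hj ⟨p.src.shift p.ν, p.μ⟩ (fun q hq => hU q (by
    simp only [PBond.tgt] at hq; rcases hq with h | h | h <;> simp [h])) ht
  have h4 := dist1_corr_su2Mean_le_local ha hj ⟨p.src, p.ν⟩ (fun q hq => hU q (by
    simp only [PBond.tgt] at hq; rcases hq with h | h | h <;> simp [h])) ht
  have hins := dist1_plaquette_with_corr_le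
    (corr su2Mean U ⟨p.src, p.μ⟩) (AveragingRT.axialAvg U ⟨p.src, p.μ⟩)
    (corr su2Mean U ⟨p.src.shift p.μ, p.ν⟩) (AveragingRT.axialAvg U ⟨p.src.shift p.μ, p.ν⟩)
    (corr su2Mean U ⟨p.src.shift p.ν, p.μ⟩) (AveragingRT.axialAvg U ⟨p.src.shift p.ν, p.μ⟩)
    (corr su2Mean U ⟨p.src, p.ν⟩) (AveragingRT.axialAvg U ⟨p.src, p.ν⟩)
  have hax' : dist1 (AveragingRT.axialAvg U ⟨p.src, p.μ⟩ * AveragingRT.axialAvg U ⟨p.src.shift p.μ, p.ν⟩ *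
      (AveragingRT.axialAvg U ⟨p.src.shift p.ν, p.μ⟩)⁻¹ * (AveragingRT.axialAvg U ⟨p.src, p.ν⟩)⁻¹) < (P.L : ℝ) ^ 2 * a := hax
  show dist1 (corr _ U ⟨p.src, p.μ⟩ * AveragingRT.axialAvg U ⟨p.src, p.μ⟩ *
      (corr _ U ⟨p.src.shift p.μ, p.ν⟩ * AveragingRT.axialAvg U ⟨p.src.shift p.μ, p.ν⟩) *
      (corr _ U ⟨p.src.shift p.ν, p.μ⟩ * AveragingRT.axialAvg U ⟨p.src.shift p.ν, p.μ⟩)⁻¹ *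
      (corr _ U ⟨p.src, p.ν⟩ * AveragingRT.axialAvg U ⟨p.src, p.ν⟩)⁻¹) < _
  nlinarith

/-- The nine coarse sites around a coarse plaquette `⟨y, μ, ν⟩` all lie within `ℓ^∞`-distance `1` of `y`
(coordinatewise `y_κ`, `y_κ ± 1`). -/
private theorem near_of_mem_nine' (y : Site P (j + 1)) {μ ν : Fin P.d} (hμν : μ ≠ ν) {z : Site P (j + 1)}
    (hz : z ∈ [y, y.shift μ, y.unshift μ, y.shift ν, y.unshift ν, (y.shift μ).shift ν, (y.shift ν).shift μ, (y.shift μ).unshift ν,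
      (y.shift ν).unshift μ]) :
    ∀ κ, z κ = y κ ∨ z κ = y κ + 1 ∨ z κ = y κ - 1 := by
  intro κ
  simp only [List.mem_cons, List.mem_nil_iff, or_false] at hz
  rcases hz with rfl | rfl | rfl | rfl | rfl | rfl | rfl | rfl | rfl <;>
    by_cases hκμ : κ = μ <;> by_cases hκν : κ = ν <;>
    simp_all [Site.shift_apply, Site.unshift_apply]

/-- **`PlaqSmallOn` form (the large-field bookkeeping shape)**: smallness (`< a`) of the fine plaquettes based in the blocks at
`ℓ^∞`-distance `≤ 1` from the corners of a set `S′` of coarse plaquettes gives smallness (`< (L² + 2((d+2)L)²)·a`) of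
`(blockAvg su2Mean).avg U` on `S′` (`(((d+2)L)²/4)·a < 1`, standing range). -/
theorem plaqSmallOn_blockAvg_su2Mean_of_near (hj : j + 1 ≤ P.m + P.K) {a : ℝ} (ha : 0 ≤ a)
    {U : GaugeField P j (Matrix.specialUnitaryGroup (Fin 2) ℂ)} (S' : Set (Plaq P (j + 1)))
    (hU : PlaqSmallOn {q : Plaq P j | ∃ p ∈ S', ∀ κ, blockOf q.src κ = p.src κ ∨ blockOf q.src κ = p.src κ + 1 ∨
        blockOf q.src κ = p.src κ - 1} a U)
    (ht : ((((P.d + 2) * P.L : ℕ) : ℝ) ^ 2 / 4) * a < 1) :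
    PlaqSmallOn S' (((P.L : ℝ) ^ 2 + 2 * (((P.d + 2) * P.L : ℕ) : ℝ) ^ 2) * a) ((blockAvg su2Mean).avg U) := by
  intro p hp
  exact dist1_plaqHol_blockAvg_su2Mean_lt_local hj ha p
    (fun q hq => hU q ⟨p, hp, near_of_mem_nine' p.src (ne_of_lt p.hμν) hq⟩) ht

end Summit.QuantumFields.YangMills.Cruxes.UVSeamRec.RarityUnionBound

end
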